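import Literature.Geometry.ComplexAnalytic.RelativeExponentialFlowKernelLattice        -- ★ p849017 (L1) `exists_frame_kernel_of_relExpFlow` (LA7-p02 (g2))
import Literature.Geometry.ComplexAnalytic.RelativeExponentialFlowHolomorphicPeriods   -- ★ p849083 (L2) `exists_holomorphic_periods_of_relExpFlow` (LA5-p01 (g2))
import HarnessLib

/-!
# Relative exponential FLOW data ⇒ a relative exponential CHART near every point of the base
# ([DeligneHodgeII1971] §4.4 (4.4.2)–(4.4.3); [BirkenhakeLange2004] §1.1 Lemma 1.1.1 (p. 8), Ch. 8 §8.7)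

Layer `Literature/Geometry/ComplexAnalytic`, namespace `Literature.Geometry.ComplexAnalytic`.  THEOREMS ONLY (no definition, no
structure, no named fact, no instance, no notation, no `sorry`).  Cell `hodgecm-mathlib` (D-0151), FLOOR 0, P6 «MOD» (crux hLiu418 =
stmt-HodgeConjecture-24832, `--supports`), «L8-PREP»: this is LA1-plan (g2)'s module of the organ letters
`F0/P6/L1/LA1-plan/g2/RelativeExponentialFlowChart.letters.v2.lean` b09cba22 — (L1) and (L2) are now ★ (`RelativeExponentialFlowKernelLattice`,
p849017; `RelativeExponentialFlowHolomorphicPeriods`, p849083) and are IMPORTED, not restated; this file carries (L3) and the assembled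
corollary VERBATIM from the letters (:95, :118), filed by the second lander (LA5-p01 (g2)) as agreed on the F0/P6 bus 04:06Z∕04:15Z.
HC_CM is proved only modulo the 7 printed citations (2 remaining: hLiu418 = stmt-HodgeConjecture-24832, h413 = stmt-HodgeConjecture-24833)
until rung 0 closes; generic complex-analytic lemmas, count-neutral.

THE SETTING is the tree's generic one of ★ `IsRelExpChartOn EB EM p U Φ ex` (`RelativeExponentialChart.lean`): a map of complex manifolds
`p : M → B` (model spaces `EM`, `EB`, finite-dimensional), a complex vector space `E` (the Lie algebra of the fibres) and a RELATIVE
EXPONENTIAL FLOW DATUM on an open `U ⊆ B`, UNBUNDLED into hypotheses: `ex : B × E → M` is `C^ω` on `U × E` (`hex`), lies over `p` (`hp`),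
has BIJECTIVE complex differential everywhere on `U × E` (`hbij`), satisfies the TRANSLATION LAW of a fibrewise `E`-action
(`hsub : ex (b, z) = ex (b, z') ↔ ex (b, z' - z) = ex (b, 0)`) and is ONTO every fibre over `U` (`hsurj`).  In print this is the relative
exponential `exp : Lie(A∕S)|_U = U × ℂ^g → A^an|_U` of an abelian scheme ([DeligneHodgeII1971] §4.4 (4.4.2); [BirkenhakeLange2004] §1.1,
Ch. 8 §8.7; [MumfordFogartyKirwan1994] App. 7A) BEFORE one knows that its fibrewise kernels are lattices varying holomorphically:

* ★ (L1) `exists_frame_kernel_of_relExpFlow` (imported) — KERNEL LATTICE: compact fibre ⇒ the stabiliser `{w | ex (b, w) = ex (b, 0)}` is a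
  full lattice `Φ₀ (ℤ^ι)`, `card ι = 2 dim_ℂ E`.
* ★ (L2) `exists_holomorphic_periods_of_relExpFlow` (imported) — HOLOMORPHIC PERIODS: lattice kernels + `M` Hausdorff ⇒ a holomorphic
  period family `Φ` with `K(v) = Φ v (ℤ^ι)` near each `m ∈ U`.
* (L3) `isRelExpChartOn_of_relExpFlow` — FLOW + PERIODS ⇒ CHART: a flow datum on `V` whose kernels are `Φ v (ℤ^ι)` for a holomorphic
  period family IS an ★ `IsRelExpChartOn EB EM p V Φ ex` (the étale field from ★ p848606).  PROVED (glue).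
* `exists_isRelExpChartOn_of_relExpFlow` — (L1)+(L2)+(L3): flow datum + compact fibres + Hausdorff ⇒ a chart near every `m ∈ U`.  PROVED.

Junk guards: compact fibres are load-bearing for (L1) (`𝔾_m`-type families have kernels of rank 1); `T2Space M` for (L2); empty `U`,
`E = 0` harmless.
-/

set_option autoImplicit false

noncomputable section

open scoped Manifold ContDiff Topology
open Set Function

namespace Literature.Geometry.ComplexAnalytic

variable {EB : Type*} [NormedAddCommGroup EB] [NormedSpace ℂ EB] [FiniteDimensional ℂ EB]
  {B : Type*} [TopologicalSpace B] [ChartedSpace EB B]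
  {E : Type*} [NormedAddCommGroup E] [NormedSpace ℂ E] [FiniteDimensional ℂ E]
  {EM : Type*} [NormedAddCommGroup EM] [NormedSpace ℂ EM]
  {M : Type*} [TopologicalSpace M] [ChartedSpace EM M]
  {ι : Type*}

/-- **(L3) FLOW + PERIODS ⇒ CHART** (glue, proved).  A relative exponential flow datum on the open `V` (`C^ω`, over `p`, bijective
differential, translation law, onto fibres) whose fibrewise stabilisers are the lattices `Φ v (ℤ^ι)` of a holomorphic period family is an
★ `IsRelExpChartOn EB EM p V Φ ex`; the étale field (local homeomorphisms with holomorphic inverses) is ★ p848606.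
[cite: DeligneHodgeII1971, §4.4 (4.4.2)] [cite: FritzscheGrauert2002, Ch. I §7 Thm. 7.6] -/
theorem isRelExpChartOn_of_relExpFlow [IsManifold 𝓘(ℂ, EB) ω B] [IsManifold 𝓘(ℂ, EM) ω M]
    {p : M → B} {V : Set B} {Φ : B → ((ι → ℝ) ≃L[ℝ] E)} {ex : B × E → M} (hV : IsOpen V)
    (hΦ : ∀ x : ι → ℝ, MDifferentiableOn 𝓘(ℂ, EB) 𝓘(ℂ, E) (fun b => Φ b x) V)
    (hex : ContMDiffOn (𝓘(ℂ, EB).prod 𝓘(ℂ, E)) 𝓘(ℂ, EM) ω ex (V ×ˢ (univ : Set E)))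
    (hp : ∀ b ∈ V, ∀ z : E, p (ex (b, z)) = b)
    (hbij : ∀ q ∈ V ×ˢ (univ : Set E), Bijective (mfderiv (𝓘(ℂ, EB).prod 𝓘(ℂ, E)) 𝓘(ℂ, EM) ex q))
    (hsub : ∀ b ∈ V, ∀ z z' : E, ex (b, z) = ex (b, z') ↔ ex (b, z' - z) = ex (b, 0))
    (hsurj : ∀ m : M, p m ∈ V → ∃ z : E, ex (p m, z) = m)
    (hker : ∀ v ∈ V, ∀ w : E, ex (v, w) = ex (v, 0) ↔ ∃ n : ι → ℤ, w = Φ v (fun i => (n i : ℝ))) :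
    IsRelExpChartOn EB EM p V Φ ex := by
  refine ⟨hV, hΦ, hex.mdifferentiableOn (by simp), hp, hsurj, ?_, ?_⟩
  · intro b hb z z'
    rw [hsub b hb z z', hker b hb (z' - z)]
    constructor
    · rintro ⟨n, hn⟩
      exact ⟨n, by rw [← hn]; abel⟩
    · rintro ⟨n, hn⟩
      exact ⟨n, by rw [hn]; abel⟩
  · exact exists_localInverse_of_bijective_mfderiv (n := ω) (by simp) hV hex hbij

/-- **(L1)+(L2)+(L3) assembled: FLOW DATUM + COMPACT FIBRES + HAUSDORFF ⇒ a relative exponential CHART near every point of `U`.**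
The form the HOME skeleton `StubRELEXP` consumes (`stub_LATTICE`, `stub_PERIODS` and the chart half of its head become one application
each, modulo «fibres of `basePoint` are compact» and «`MA` is Hausdorff»). [cite: DeligneHodgeII1971, §4.4 (4.4.2)] -/
theorem exists_isRelExpChartOn_of_relExpFlow [Fintype ι] [T2Space M] [IsManifold 𝓘(ℂ, EB) ω B] [IsManifold 𝓘(ℂ, EM) ω M]
    {p : M → B} {U : Set B} {ex : B × E → M} (hU : IsOpen U)
    (hex : ContMDiffOn (𝓘(ℂ, EB).prod 𝓘(ℂ, E)) 𝓘(ℂ, EM) ω ex (U ×ˢ (univ : Set E)))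
    (hp : ∀ b ∈ U, ∀ z : E, p (ex (b, z)) = b)
    (hbij : ∀ q ∈ U ×ˢ (univ : Set E), Bijective (mfderiv (𝓘(ℂ, EB).prod 𝓘(ℂ, E)) 𝓘(ℂ, EM) ex q))
    (hsub : ∀ b ∈ U, ∀ z z' : E, ex (b, z) = ex (b, z') ↔ ex (b, z' - z) = ex (b, 0))
    (hsurj : ∀ m : M, p m ∈ U → ∃ z : E, ex (p m, z) = m)
    (hι : Fintype.card ι = 2 * Module.finrank ℂ E)
    (hcpt : ∀ b ∈ U, IsCompact (p ⁻¹' {b}))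
    {m : B} (hm : m ∈ U) :
    ∃ V : Set B, m ∈ V ∧ V ⊆ U ∧ ∃ Φ : B → ((ι → ℝ) ≃L[ℝ] E), IsRelExpChartOn EB EM p V Φ ex := by
  have hlat : ∀ b ∈ U, ∃ Φ₀ : (ι → ℝ) ≃L[ℝ] E,
      ∀ w : E, ex (b, w) = ex (b, 0) ↔ ∃ n : ι → ℤ, w = Φ₀ (fun i => (n i : ℝ)) :=
    fun b hb => exists_frame_kernel_of_relExpFlow hU hex hp hbij hsub hsurj hι hb (hcpt b hb)
  obtain ⟨V, hVopen, hmV, hVU, Φ, hΦ, hker⟩ :=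
    exists_holomorphic_periods_of_relExpFlow hU hex hp hbij hlat hm
  refine ⟨V, hmV, hVU, Φ, ?_⟩
  exact isRelExpChartOn_of_relExpFlow hVopen hΦ (hex.mono (prod_mono hVU le_rfl))
    (fun b hb z => hp b (hVU hb) z) (fun q hq => hbij q ⟨hVU hq.1, hq.2⟩)
    (fun b hb z z' => hsub b (hVU hb) z z') (fun m' hm' => hsurj m' (hVU hm')) hker

end Literature.Geometry.ComplexAnalytic

end
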